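import Summits.QuantumFields.YangMills.Theorems.UnitScaleTiltProp7Lane2PartitionOfUnityGrid
import Summits.QuantumFields.YangMills.Theorems.UnitScaleTiltProp7Lane2PatchGeometry
import HarnessLib

/-!
# Route `UnitScaleTilt`, crux K1 «MinimiserStabilityRegPr» (stmt-QuantumFields-19200) — route-R E′ (A′), LANE II «DIVERGENCE RECOVERY AT CURVED `W`» (★★OWNER RULING №23),
# (B7) member geometry [I-9] «(Z0-c)»: **THE THREE RESOURCE ROWS OF `hPatch` AS ONE CALL EACH** — a site-indexed resource supported on the displayed centre set `Zc = (grid).image corner`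
# and bounded per centre by a grid-patch sum is bounded in total by `ν·(total weight)`, `ν = (2⌊(D+R−1)∕R⌋+1)³` (px9's multiplicity), `ν ≤ 729` at `D = 2R + 2`, `= 343` for `R ≥ 2`

Cell `ym3-torus` ∕ width seat `ym3-torus-px4` (gen 9, «width 4»).  Knit-side complement of ✓p718534 `…Lane2PartitionOfUnityGrid` (Z0-a), ✓p718711 `…Lane2CutoffPackageGrid` (Z0-b),
✓p719020 `…Lane2ChartInGrid` (hT_c); the seven FAMILY rows are `ym3-torus-px12` g9's (FAM), not touched here.  THEOREMS ONLY (0 `def`, 0 `sorry`); `--supports stmt-QuantumFields-19200 --as helper`,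
count-neutral.  YM₃ on T³ is a ladder rung (R3), NOT d = 4, NOT infinite volume, NOT a mass gap, NOT the Clay problem; nothing here claims (B7), (REC), `hN06`, E′, EX or the gap.

WHY.  The frozen schema `hPatch` (✓`Prop7DivRecoveryPatchesToRows.hRows_of_core_and_patches` :81–:83) displays `∑ i, Ni i ≤ ν * ‖y‖²`, `∑ i, Cui i ≤ ν * (CURL + 1029e‖y‖²)`,
`∑ i, Asi i ≤ ν * AVG` over ALL fine sites `i`; the PATCHES1 file produces, per centre `c = corner g`, a resource bounded by a nonnegative weight summed over px9's site ∕ bond ∕ coarse-bond patch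
at `g`; px9's ✓`Prop7Lane2PatchGeometry.sum_grid_sum_patch_le_*` counts every object at most `ν` times over the GRID.  This file is the two-line bridge: re-index `∑ i` (zero off `Zc`) as
`∑ g ∈ grid` through ✓`corner_injOn`, then apply px9.  Every numeral is explicit; nothing reads `K n m W` beyond the letters.

WHAT IS PROVED (ns `…Theorems.Prop7Lane2GridResourceRows`; member `F n K`, scale exponent `s`, `n ≤ K`, `s ≤ m + n`):
* ★ `sum_eq_sum_grid_of_zero_off` — `∑ c, f c = ∑ g ∈ grid, f (corner g)` for every `f : Site (F.P K) 0 → M` vanishing off `Zc` (`AddCommMonoid M`).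
* ★★ `sum_le_mul_sum_of_patch_sites` ∕ ★★ `sum_le_mul_sum_of_patch_bonds` ∕ ★★ `sum_le_mul_sum_of_patch_coarseBonds` — if `Ni c = 0` off `Zc` and `Ni (corner g) ≤ Σ_(patch at g, radius D) w` for a
  nonnegative weight `w` on fine sites ∕ fine bonds (`pos b := iterBlockOf (K−n) b.src`) ∕ coarse bonds (`pos ĉ := ĉ.src`), then `∑ c, Ni c ≤ ((2⌊(D+L^s−1)∕L^s⌋+1)³ : ℕ) · Σ w`
  (px9's filter text VERBATIM, any `D`).
* `multiplicity_le_729` (`D := 2L^s + 2` ⇒ the factor is `≤ 729`, any `s`) · `multiplicity_eq_343` (`2 ≤ L^s` ⇒ `= 343`) — the ONE `ν` of `hPatch` is chosen before `s`, so the uniform `729`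
  (or `343` once `s ≥ 1` is in force) is what the knit names.
HONEST SCOPE.  `Finset` re-indexing and double counting over landed rows; nothing of the lattice gauge theory, of print, of (B7)∕(REC)∕`hN06`∕the crux is asserted; rung R3, not Clay; YM gap
NOT proved.

References: T. Bałaban, CMP 99 (1985) 389–434 [Balaban1985BackgroundPropagators] ((3.100) pp.413–414: localisation at scale `M`, the cubes overlap finitely often); [folklore]
(double counting, `Finset.sum_image`).
-/

set_option autoImplicit false

noncomputable section

open scoped BigOperators

namespace Summit.QuantumFields.YangMills.Theorems.Prop7Lane2GridResourceRows

open Literature.MathematicalPhysics.QuantumFieldTheory.Balaban1983to89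
open Literature.MathematicalPhysics.QuantumFieldTheory.Balaban1983to89.T3ContinuumYM3Torus
open B5Eq118OneStroke (iterBlockOf)
open Summit.QuantumFields.YangMills.Theorems.Prop7Lane2PartitionOfUnityGrid (corner_injOn)
open Summit.QuantumFields.YangMills.Theorems.Prop7Lane2PatchGeometry (sum_grid_sum_patch_le_sites sum_grid_sum_patch_le_bonds sum_grid_sum_patch_le_coarseBonds)

variable (F : T3Family) (n K s : ℕ)

/-! ## §1 Re-indexing a site sum supported on the centre set by the grid -/

/-- ★ **`∑ i = ∑ g ∈ grid` FOR FUNCTIONS SUPPORTED ON THE CENTRE SET**: if `f c = 0` for every fine site `c` off `Zc = (grid).image corner`, then `∑ c, f c = ∑ g ∈ grid, f (corner g)`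
(`Finset.sum_subset` ∘ `Finset.sum_image` over ✓`corner_injOn`). [folklore] -/
theorem sum_eq_sum_grid_of_zero_off (hnK : n ≤ K) (hs : s ≤ F.m + n) {M : Type*} [AddCommMonoid M] (f : Site (F.P K) 0 → M)
    (hf : ∀ c : Site (F.P K) 0, c ∉ (((Fintype.piFinset fun _ : Fin 3 => Finset.range (2 * F.L ^ (F.m + n - s)))).image
        (fun g κ => ((g κ * (F.L ^ s * F.L ^ (K - n)) : ℕ) : ZMod ((F.P K).sitesPerDir 0))) : Finset (Site (F.P K) 0)) → f c = 0) :
    ∑ c, f c = ∑ g ∈ (Fintype.piFinset fun _ : Fin 3 => Finset.range (2 * F.L ^ (F.m + n - s))), f (fun κ => ((g κ * (F.L ^ s * F.L ^ (K - n)) : ℕ) : ZMod ((F.P K).sitesPerDir 0))) := by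
  classical
  rw [← Finset.sum_subset (Finset.subset_univ _) fun c _ hc => hf c hc]
  exact Finset.sum_image (corner_injOn F n K s hnK hs)

/-! ## §2 The three resource rows: per-centre patch bounds ⟹ `∑ i, Ni i ≤ ν · Σ w` -/

/-- ★★ **RESOURCE ROW OVER FINE SITES**: a site-indexed resource vanishing off `Zc` and bounded at each centre `corner g` by the nonnegative site weight `w` summed over px9's site patch at `g`
(radius `D` blocks, `pos := iterBlockOf (K−n)`) has total `≤ (2⌊(D+L^s−1)∕L^s⌋+1)³ · Σ_x w x`. [cite: Balaban1985BackgroundPropagators, (3.100) p.414] -/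
theorem sum_le_mul_sum_of_patch_sites (hnK : n ≤ K) (hs : s ≤ F.m + n) (D : ℕ) (Ni : Site (F.P K) 0 → ℝ) (w : Site (F.P K) 0 → ℝ)
    (hw : ∀ x, 0 ≤ w x) (hoff : ∀ c : Site (F.P K) 0, c ∉ (((Fintype.piFinset fun _ : Fin 3 => Finset.range (2 * F.L ^ (F.m + n - s)))).image
        (fun g κ => ((g κ * (F.L ^ s * F.L ^ (K - n)) : ℕ) : ZMod ((F.P K).sitesPerDir 0))) : Finset (Site (F.P K) 0)) → Ni c = 0)
    (hNi : ∀ g ∈ (Fintype.piFinset fun _ : Fin 3 => Finset.range (2 * F.L ^ (F.m + n - s))),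
      Ni (fun κ => ((g κ * (F.L ^ s * F.L ^ (K - n)) : ℕ) : ZMod ((F.P K).sitesPerDir 0)))
        ≤ ∑ x ∈ Finset.univ.filter (fun x : Site (F.P K) 0 => ∀ κ : Fin 3,
          min ((iterBlockOf (K - n) x) κ - ((g κ * F.L ^ s : ℕ) : ZMod ((F.P K).sitesPerDir (K - n)))).val
            ((((g κ * F.L ^ s : ℕ) : ZMod ((F.P K).sitesPerDir (K - n)))) - (iterBlockOf (K - n) x) κ).val ≤ D), w x) :
    ∑ c, Ni c ≤ ((2 * ((D + F.L ^ s - 1) / F.L ^ s) + 1) ^ 3 : ℕ) * ∑ x, w x := by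
  classical
  rw [sum_eq_sum_grid_of_zero_off F n K s hnK hs Ni hoff]
  exact (Finset.sum_le_sum hNi).trans (sum_grid_sum_patch_le_sites F n K s hnK hs D w hw)

/-- ★★ **RESOURCE ROW OVER FINE BONDS** (`N_c ≤ c₀Σ_(T_c)‖y b‖_F²`-shape; `pos b := iterBlockOf (K−n) b.src`): total `≤ (2⌊(D+L^s−1)∕L^s⌋+1)³ · Σ_b w b`.
[cite: Balaban1985BackgroundPropagators, (3.100) p.414] -/
theorem sum_le_mul_sum_of_patch_bonds (hnK : n ≤ K) (hs : s ≤ F.m + n) (D : ℕ) (Ni : Site (F.P K) 0 → ℝ) (w : PBond (F.P K) 0 → ℝ)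
    (hw : ∀ b, 0 ≤ w b) (hoff : ∀ c : Site (F.P K) 0, c ∉ (((Fintype.piFinset fun _ : Fin 3 => Finset.range (2 * F.L ^ (F.m + n - s)))).image
        (fun g κ => ((g κ * (F.L ^ s * F.L ^ (K - n)) : ℕ) : ZMod ((F.P K).sitesPerDir 0))) : Finset (Site (F.P K) 0)) → Ni c = 0)
    (hNi : ∀ g ∈ (Fintype.piFinset fun _ : Fin 3 => Finset.range (2 * F.L ^ (F.m + n - s))),
      Ni (fun κ => ((g κ * (F.L ^ s * F.L ^ (K - n)) : ℕ) : ZMod ((F.P K).sitesPerDir 0)))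
        ≤ ∑ b ∈ Finset.univ.filter (fun b : PBond (F.P K) 0 => ∀ κ : Fin 3,
          min ((iterBlockOf (K - n) b.src) κ - ((g κ * F.L ^ s : ℕ) : ZMod ((F.P K).sitesPerDir (K - n)))).val
            ((((g κ * F.L ^ s : ℕ) : ZMod ((F.P K).sitesPerDir (K - n)))) - (iterBlockOf (K - n) b.src) κ).val ≤ D), w b) :
    ∑ c, Ni c ≤ ((2 * ((D + F.L ^ s - 1) / F.L ^ s) + 1) ^ 3 : ℕ) * ∑ b, w b := by
  classical
  rw [sum_eq_sum_grid_of_zero_off F n K s hnK hs Ni hoff]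
  exact (Finset.sum_le_sum hNi).trans (sum_grid_sum_patch_le_bonds F n K s hnK hs D w hw)

/-- ★★ **RESOURCE ROW OVER COARSE BONDS** (`As_c`-shape; `pos ĉ := ĉ.src`): total `≤ (2⌊(D+L^s−1)∕L^s⌋+1)³ · Σ_ĉ w ĉ`. [cite: Balaban1985BackgroundPropagators, (3.100) p.414] -/
theorem sum_le_mul_sum_of_patch_coarseBonds (hnK : n ≤ K) (hs : s ≤ F.m + n) (D : ℕ) (Ni : Site (F.P K) 0 → ℝ) (w : PBond (F.P K) (K - n) → ℝ)
    (hw : ∀ c, 0 ≤ w c) (hoff : ∀ c : Site (F.P K) 0, c ∉ (((Fintype.piFinset fun _ : Fin 3 => Finset.range (2 * F.L ^ (F.m + n - s)))).image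
        (fun g κ => ((g κ * (F.L ^ s * F.L ^ (K - n)) : ℕ) : ZMod ((F.P K).sitesPerDir 0))) : Finset (Site (F.P K) 0)) → Ni c = 0)
    (hNi : ∀ g ∈ (Fintype.piFinset fun _ : Fin 3 => Finset.range (2 * F.L ^ (F.m + n - s))),
      Ni (fun κ => ((g κ * (F.L ^ s * F.L ^ (K - n)) : ℕ) : ZMod ((F.P K).sitesPerDir 0)))
        ≤ ∑ c ∈ Finset.univ.filter (fun c : PBond (F.P K) (K - n) => ∀ κ : Fin 3,
          min ((c.src) κ - ((g κ * F.L ^ s : ℕ) : ZMod ((F.P K).sitesPerDir (K - n)))).val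
            ((((g κ * F.L ^ s : ℕ) : ZMod ((F.P K).sitesPerDir (K - n)))) - (c.src) κ).val ≤ D), w c) :
    ∑ c, Ni c ≤ ((2 * ((D + F.L ^ s - 1) / F.L ^ s) + 1) ^ 3 : ℕ) * ∑ c, w c := by
  classical
  rw [sum_eq_sum_grid_of_zero_off F n K s hnK hs Ni hoff]
  exact (Finset.sum_le_sum hNi).trans (sum_grid_sum_patch_le_coarseBonds F n K s hnK hs D w hw)

/-! ## §3 The multiplicity at the record radius `D = 2L^s + 2` -/

/-- **`ν ≤ 729` UNIFORMLY IN `s`**: at `D = 2·L^s + 2`, `(2⌊(D + L^s − 1)∕L^s⌋ + 1)³ ≤ 9³ = 729` (`⌊(3R+1)∕R⌋ ≤ 4`). [folklore] -/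
theorem multiplicity_le_729 : (2 * ((2 * F.L ^ s + 2 + F.L ^ s - 1) / F.L ^ s) + 1) ^ 3 ≤ 729 := by
  have hL : 0 < F.L := by have := F.hL.2; omega
  have hR : 1 ≤ F.L ^ s := Nat.one_le_pow _ _ hL
  have h : (2 * F.L ^ s + 2 + F.L ^ s - 1) / F.L ^ s ≤ 4 := by
    apply Nat.div_le_of_le_mul
    omega
  calc (2 * ((2 * F.L ^ s + 2 + F.L ^ s - 1) / F.L ^ s) + 1) ^ 3 ≤ (2 * 4 + 1) ^ 3 := Nat.pow_le_pow_left (by omega) 3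
    _ = 729 := by norm_num

/-- **`ν = 343` ONCE `L^s ≥ 2`**: at `D = 2·L^s + 2`, `(2⌊(D + L^s − 1)∕L^s⌋ + 1)³ = 7³ = 343` (`⌊(3R+1)∕R⌋ = 3` for `R ≥ 2`). [folklore] -/
theorem multiplicity_eq_343 (hR2 : 2 ≤ F.L ^ s) : (2 * ((2 * F.L ^ s + 2 + F.L ^ s - 1) / F.L ^ s) + 1) ^ 3 = 343 := by
  have h : (2 * F.L ^ s + 2 + F.L ^ s - 1) / F.L ^ s = 3 := by
    have e : 2 * F.L ^ s + 2 + F.L ^ s - 1 = 1 + 3 * F.L ^ s := by omega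
    rw [e, Nat.add_mul_div_right _ _ (by omega), Nat.div_eq_of_lt (by omega)]
  rw [h]; norm_num

/-- ★★ **THE `‖y‖²`-ROW IN `hPatch`'S SHAPE, UNIFORM `ν = 729`**: with `D := 2·L^s + 2` (the radius of ✓`Prop7Lane2ChartInGrid.transl_mem_gridPatch_bonds`), a resource supported on `Zc` and
bounded per centre by the bond patch sum of a nonnegative `w` satisfies `∑ i, Ni i ≤ 729 · Σ_b w b` — so with `w b := c₀‖y b‖_F²` and ✓`norm_toL2_sq` the displayed `∑ i, Ni i ≤ ν * ‖y‖ ^ 2`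
holds at `ν := 729` for every `s`. [cite: Balaban1985BackgroundPropagators, (3.100) p.414] -/
theorem sum_le_729_mul_sum_of_patch_bonds (hnK : n ≤ K) (hs : s ≤ F.m + n) (Ni : Site (F.P K) 0 → ℝ) (w : PBond (F.P K) 0 → ℝ)
    (hw : ∀ b, 0 ≤ w b) (hoff : ∀ c : Site (F.P K) 0, c ∉ (((Fintype.piFinset fun _ : Fin 3 => Finset.range (2 * F.L ^ (F.m + n - s)))).image
        (fun g κ => ((g κ * (F.L ^ s * F.L ^ (K - n)) : ℕ) : ZMod ((F.P K).sitesPerDir 0))) : Finset (Site (F.P K) 0)) → Ni c = 0)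
    (hNi : ∀ g ∈ (Fintype.piFinset fun _ : Fin 3 => Finset.range (2 * F.L ^ (F.m + n - s))),
      Ni (fun κ => ((g κ * (F.L ^ s * F.L ^ (K - n)) : ℕ) : ZMod ((F.P K).sitesPerDir 0)))
        ≤ ∑ b ∈ Finset.univ.filter (fun b : PBond (F.P K) 0 => ∀ κ : Fin 3,
          min ((iterBlockOf (K - n) b.src) κ - ((g κ * F.L ^ s : ℕ) : ZMod ((F.P K).sitesPerDir (K - n)))).val
            ((((g κ * F.L ^ s : ℕ) : ZMod ((F.P K).sitesPerDir (K - n)))) - (iterBlockOf (K - n) b.src) κ).val ≤ 2 * F.L ^ s + 2), w b) :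
    ∑ c, Ni c ≤ 729 * ∑ b, w b := by
  refine (sum_le_mul_sum_of_patch_bonds F n K s hnK hs (2 * F.L ^ s + 2) Ni w hw hoff hNi).trans ?_
  have hsum : 0 ≤ ∑ b, w b := Finset.sum_nonneg fun b _ => hw b
  have h729 : (((2 * ((2 * F.L ^ s + 2 + F.L ^ s - 1) / F.L ^ s) + 1) ^ 3 : ℕ) : ℝ) ≤ 729 := by
    exact_mod_cast multiplicity_le_729 F s
  exact mul_le_mul_of_nonneg_right h729 hsum

end Summit.QuantumFields.YangMills.Theorems.Prop7Lane2GridResourceRows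

end
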